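import Summits.QuantumFields.GaugeBoot.LoopClasses
import Summits.QuantumFields.GaugeBoot.Certificates.C1SU2b4
import HarnessLib

/-!
# Gauge-boot, row C1-SU2_b4: binding the certificate of record to the torus plaquette expectation

Cell `pub-gaugeboot` (HOME `run/shared/lean/pub/pub-gaugeboot/`), seat lean1, FANOUT-PLAN A26(c) (the ONE binding
theorem for the canary certificate of record). Certificate half: `Certificates/C1SU2b4.lean` (seat lean3,
`var_le_of_feasible`: every real `y` with `y 0 = 1`, `|y v| ≤ 1`, the two equality rows and the `9 × 9` Gram block
`Σ_v y_v F_v ⪰ 0` has `y 1 ≤ 457909750469907778563025/2⁷⁹`; certificate sha256 `80284867…`, problem `61c0f70d…`).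
This file supplies the lattice-gauge-theory half: the variables ARE torus Wilson-loop expectations and they ARE
feasible — except for the two loop-equation rows, which stay hypotheses until task L1 lands them.

HONEST FRAMING (page 1 of every file of this cell): a certified UPPER bound on ONE lattice expectation — the
plaquette of two-dimensional `SU(2)` lattice gauge theory at standard Wilson coupling `β_std = 4` (tree coupling `2`)
on every torus `(ℤ/L)²` — CONDITIONAL on the loop equations (1eq), (2eq); NOT a mass gap, NOT a continuum limit, NOT
a string tension, NOT large `N`, NOT Yang–Mills-summit-bearing (`FixedCouplingUltralocality`,
`PerturbativeInvisibility`). In `D = 2` the exact value is known (`I₂(4)/I₁(4) = 0.658…`); the point is the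
end-to-end kernel check of the pipeline problem data → loop classes → Gram positivity → dual certificate → bound.

## Content
* the nine based loops `O` of the problem file's Gram block (`∅`, the four plaquettes at the origin in both
  orientations) and the seven representative words `rep` of its variables `1, u, d, r, a, b_same, b_opp`;
* `canon_table` (by `decide`): every Gram entry `Oᵢ⁻¹ Oⱼ` is carried to the representative of its class (the problem
  file's `gram_class_table`) by hyperoctahedral moves, reversal, rotations and free reduction — so, by
  `LoopClasses.wilsonExpectation_wordLoop_canon`, `⟨W_0(Oᵢ⁻¹ Oⱼ)⟩ = y (cls i j)` on every torus (`gram_entry`);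
* feasibility: `y 0 = 1`, `|y v| ≤ 1` (`WordLoop`), and `(C1SU2b4.gramBlock y).PosSemidef` from the Gram positivity
  of the torus Wilson state (`WordLoop.sum_mul_wilsonExpectation_wordLoop_nonneg`) — the `F_v` of the certificate file
  are checked against the class table by `decide` (`FQ_apply`);
* `row_C1_SU2_b4`: `(1eq) → (2eq) → plaquetteExpectation 2 2 L 4 ≤ 457909750469907778563025/604462909807314587353088`.
-/

noncomputable section

open MeasureTheory Matrix
open Literature.MathematicalPhysics.QuantumFieldTheory

namespace Summit.QuantumFields.GaugeBoot

namespace Rows.C1SU2b4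

open Certificates.C1SU2b4 (FQ rowEQ rhsQ rhoQ gramBlock var_le_of_feasible)

/-! ## Words of the problem file (axis `0 = x`, `1 = y`) -/

/-- The nine based loops of the Gram block `H_origin_cutoff4`, problem-file order `∅, NE+, NE-, NW+, NW-, SW+, SW-, SE+, SE-`. -/
def O : Fin 9 → Word 2 :=
  ![[], [.fwd 0, .fwd 1, .bwd 0, .bwd 1], [.fwd 1, .fwd 0, .bwd 1, .bwd 0], [.fwd 1, .bwd 0, .bwd 1, .fwd 0], [.bwd 0, .fwd 1, .fwd 0, .bwd 1], [.bwd 0, .bwd 1, .fwd 0, .fwd 1], [.bwd 1, .bwd 0, .fwd 1, .fwd 0], [.bwd 1, .fwd 0, .fwd 1, .bwd 0], [.fwd 0, .bwd 1, .bwd 0, .fwd 1]]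

/-- Representative words of the seven variables `1, u, d, r, a, b_same, b_opp` (problem-file labels, verbatim). -/
def rep : Fin 7 → Word 2 :=
  ![[], [.fwd 0, .fwd 1, .bwd 0, .bwd 1], [.fwd 0, .fwd 1, .bwd 0, .bwd 1, .fwd 0, .fwd 1, .bwd 0, .bwd 1], [.fwd 0, .fwd 0, .fwd 1, .bwd 0, .bwd 0, .bwd 1], [.fwd 1, .fwd 0, .bwd 1, .bwd 0, .fwd 1, .bwd 0, .bwd 1, .fwd 0], [.fwd 0, .fwd 1, .bwd 0, .bwd 1, .bwd 0, .bwd 1, .fwd 0, .fwd 1], [.fwd 0, .fwd 1, .bwd 0, .bwd 1, .bwd 1, .bwd 0, .fwd 1, .fwd 0]]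

/-- The class table (`meta.gram_class_table`): Gram entry `(i, j)` is the variable `cls i j`. -/
def cls : Fin 9 → Fin 9 → Fin 7 :=
  ![![0, 1, 1, 1, 1, 1, 1, 1, 1],
    ![1, 0, 2, 4, 3, 6, 5, 4, 3],
    ![1, 2, 0, 3, 4, 5, 6, 3, 4],
    ![1, 4, 3, 0, 2, 4, 3, 6, 5],
    ![1, 3, 4, 2, 0, 3, 4, 5, 6],
    ![1, 6, 5, 4, 3, 0, 2, 4, 3],
    ![1, 5, 6, 3, 4, 2, 0, 3, 4],
    ![1, 4, 3, 6, 5, 4, 3, 0, 2],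
    ![1, 3, 4, 5, 6, 3, 4, 2, 0]]

/-- Canonicalisation witnesses: hyperoctahedral moves (found by search; checked by `decide` below). -/
def wMoves : Fin 9 → Fin 9 → List (Move 2) :=
  ![![[], [], [], [], [], [], [], [], []],
    ![[], [], [], [], [], [], [], [Move.perm (Equiv.swap 0 1)], [Move.perm (Equiv.swap 0 1)]],
    ![[], [], [], [], [], [], [], [Move.perm (Equiv.swap 0 1)], [Move.perm (Equiv.swap 0 1)]],
    ![[], [], [], [], [], [Move.perm (Equiv.swap 0 1)], [Move.perm (Equiv.swap 0 1)], [Move.refl0], [Move.refl0]],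
    ![[], [], [], [], [], [Move.perm (Equiv.swap 0 1)], [Move.perm (Equiv.swap 0 1)], [Move.refl0], [Move.refl0]],
    ![[], [], [], [Move.perm (Equiv.swap 0 1)], [Move.perm (Equiv.swap 0 1)], [], [], [], []],
    ![[], [], [], [Move.perm (Equiv.swap 0 1)], [Move.perm (Equiv.swap 0 1)], [], [], [], []],
    ![[], [Move.perm (Equiv.swap 0 1)], [Move.perm (Equiv.swap 0 1)], [Move.refl0], [Move.refl0], [], [], [], []],
    ![[], [Move.perm (Equiv.swap 0 1)], [Move.perm (Equiv.swap 0 1)], [Move.refl0], [Move.refl0], [], [], [], []]]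

/-- Canonicalisation witnesses: reversal flags. -/
def wRev : Fin 9 → Fin 9 → Bool :=
  ![![false, false, true, false, true, false, true, false, true],
    ![true, false, true, false, true, true, true, true, false],
    ![false, false, false, false, true, false, false, true, false],
    ![true, true, true, false, true, true, false, false, false],
    ![false, false, false, false, false, true, false, true, true],
    ![true, false, true, false, false, false, true, true, true],
    ![false, false, true, true, true, false, false, false, false],
    ![true, false, false, true, false, false, true, false, true],
    ![false, true, true, true, false, false, true, false, false]]

/-- Canonicalisation witnesses: first rotation. -/
def wRot₁ : Fin 9 → Fin 9 → ℕ :=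
  ![![0, 0, 0, 0, 0, 0, 0, 0, 0],
    ![0, 0, 0, 0, 1, 0, 0, 0, 0],
    ![0, 0, 0, 0, 0, 0, 0, 1, 0],
    ![0, 0, 0, 0, 0, 0, 1, 0, 0],
    ![0, 1, 0, 0, 0, 0, 0, 0, 0],
    ![0, 0, 0, 0, 0, 0, 0, 0, 1],
    ![0, 0, 0, 1, 0, 0, 0, 0, 0],
    ![0, 0, 1, 0, 0, 0, 0, 0, 0],
    ![0, 0, 0, 0, 0, 1, 0, 0, 0]]

/-- Canonicalisation witnesses: second rotation. -/
def wRot₂ : Fin 9 → Fin 9 → ℕ :=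
  ![![0, 0, 0, 3, 3, 2, 2, 1, 1],
    ![0, 0, 0, 0, 2, 4, 4, 4, 5],
    ![0, 0, 0, 5, 4, 0, 0, 2, 0],
    ![3, 0, 5, 0, 3, 3, 5, 0, 0],
    ![3, 2, 4, 3, 0, 2, 7, 4, 4],
    ![2, 4, 0, 3, 2, 0, 2, 7, 5],
    ![2, 4, 0, 5, 7, 2, 0, 2, 3],
    ![1, 4, 2, 0, 4, 7, 2, 0, 1],
    ![1, 5, 0, 0, 4, 5, 3, 1, 0]]


/-- **The class table is correct as a statement about canonical forms** (closed computation): for every entry the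
witnessed moves keep the word closed and the pipeline lands exactly on the class representative. -/
theorem canon_table : ∀ i j : Fin 9,
    Word.disp (Word.acts (wMoves i j) (Word.reverse (O i) ++ O j)) = 0 ∧
      Word.canon (wMoves i j) (wRev i j) (wRot₁ i j) (wRot₂ i j) (Word.reverse (O i) ++ O j) = rep (cls i j) := by
  decide

/-- The based loops are closed (zero net displacement). -/
theorem disp_O : ∀ i : Fin 9, Word.disp (O i) = 0 := by decide

/-- The class table is symmetric. -/
theorem cls_symm : ∀ i j : Fin 9, cls j i = cls i j := by decide

/-- The tree's plaquette word is the representative of the variable `u`. -/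
theorem rep_one : rep 1 = Word.plaquette (0 : Fin 2) 1 := by decide

/-- **The certificate file's block data agree with the class table**: `F_v i j = [cls i j = v]`. -/
theorem FQ_apply : ∀ (v : Fin 7) (i j : Fin 9), FQ v i j = if cls i j = v then 1 else 0 := by decide

/-! ## The variables: torus expectations at `β_std = 4` (`β_tree = 4/2`) -/

variable (L : ℕ) [NeZero L]

/-- `W w = ⟨W_0(w)⟩`: the torus expectation of the loop variable of `w` for `SU(2)` at tree coupling `4/2`. -/
def W (w : Word 2) : ℝ :=
  wilsonExpectation (suRep 2) ((4 : ℝ) / (2 : ℕ)) (wordLoop (suRep 2) (0 : Site 2 L) w)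

/-- The seven variables `y = (1, u, d, r, a, b_same, b_opp)` as torus expectations. -/
def y (v : Fin 7) : ℝ := W L (rep v)

/-- `y 0 = ⟨W(∅)⟩ = 1`. -/
theorem y_zero : y L 0 = 1 := by
  haveI := isProbabilityMeasure_wilsonMeasure (d := 2) (L := L) (G := SU 2) (suRep 2) (continuous_suRep 2)
    ((4 : ℝ) / (2 : ℕ))
  show wilsonExpectation (suRep 2) ((4 : ℝ) / (2 : ℕ)) (wordLoop (suRep 2) (0 : Site 2 L) ([] : Word 2)) = 1
  rw [wordLoop_nil (suRep 2) (by norm_num) 0]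
  simp [wilsonExpectation]

/-- `|y v| ≤ 1`. -/
theorem abs_y_le_one (v : Fin 7) : |y L v| ≤ 1 :=
  abs_wilsonExpectation_wordLoop_le_one (suRep 2) (continuous_suRep 2) _ 0 (rep v)

/-- **Every Gram entry is a variable**: `⟨W_0(Oᵢ⁻¹ Oⱼ)⟩ = y (cls i j)` on every torus. -/
theorem gram_entry (i j : Fin 9) : W L (Word.reverse (O i) ++ O j) = y L (cls i j) := by
  obtain ⟨hd, hc⟩ := canon_table i j
  unfold y W
  rw [← hc]
  exact wilsonExpectation_wordLoop_canon (suRep 2) (continuous_suRep 2) _ _ _ _ _ _ hd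

/-- **Gram positivity in the variables**: `0 ≤ ∑ᵢⱼ cᵢ cⱼ y (cls i j)` for all real `c`. -/
theorem gram_nonneg (c : Fin 9 → ℝ) : 0 ≤ ∑ i, ∑ j, c i * c j * y L (cls i j) := by
  have h := sum_mul_wilsonExpectation_wordLoop_nonneg (suRep 2) (continuous_suRep 2) ((4 : ℝ) / (2 : ℕ))
    (0 : Site 2 L) O (fun i => Word.endpoint_eq_self_of_disp 0 (disp_O i)) c
  have h' : ∀ i j : Fin 9, wilsonExpectation (suRep 2) ((4 : ℝ) / (2 : ℕ))
      (wordLoop (suRep 2) (0 : Site 2 L) (Word.reverse (O i) ++ O j)) = y L (cls i j) := fun i j => gram_entry L i j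
  simp only [h'] at h
  exact h

/-! ## Feasibility for the certificate file and the bound -/

/-- The certificate file's block `Σ_v y_v F_v` has entries `y (cls i j)`. -/
theorem gramBlock_apply (i j : Fin 9) : gramBlock (y L) i j = y L (cls i j) := by
  simp only [gramBlock, Matrix.sum_apply, Matrix.smul_apply, Matrix.map_apply, FQ_apply, smul_eq_mul]
  rw [Finset.sum_eq_single (cls i j) (fun v _ hv => by simp [Ne.symm hv]) (fun h => absurd (Finset.mem_univ _) h)]
  simp

/-- **The Gram block of the torus variables is positive semidefinite** (Class-A `H` positivity of the torus
Wilson state, transported through the class table). -/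
theorem gramBlock_posSemidef : (gramBlock (y L)).PosSemidef := by
  refine PosSemidef.of_dotProduct_mulVec_nonneg ?_ fun x => ?_
  · ext i j
    simp only [conjTranspose_apply, star_trivial, gramBlock_apply, cls_symm]
  · have h := gram_nonneg L x
    simp only [dotProduct, mulVec, star_trivial, gramBlock_apply, Finset.mul_sum] at h ⊢
    refine h.trans_eq (Finset.sum_congr rfl fun i _ => Finset.sum_congr rfl fun j _ => by ring)

/-- `|y v| ≤ ρ_v = 1` in the certificate file's form. -/
theorem abs_y_le_rho (v : Fin 7) (_hv : v ≠ 0) : |y L v| ≤ (rhoQ v : ℝ) := by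
  have h := abs_y_le_one L v
  fin_cases v <;> simpa [rhoQ] using h

/-- The two loop-equation rows in the certificate file's form, from (1eq) and (2eq). -/
theorem rows_of_loopEquations (h1eq : -1 + 3 / 2 * y L 1 + y L 2 - y L 3 + y L 4 = 0)
    (h2eq : y L 3 - y L 4 - y L 5 + y L 6 = 0) :
    ∀ e : Fin 2, ∑ v, (rowEQ e v : ℝ) * y L v = rhsQ e := by
  have hy0 := y_zero L
  intro e
  fin_cases e
  · simp [rowEQ, rhsQ, Fin.sum_univ_succ]
    linarith
  · simp [rowEQ, rhsQ, Fin.sum_univ_succ]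
    linarith

/-- The tree's plaquette expectation is the variable `u`. -/
theorem plaquetteExpectation_eq_y_one : plaquetteExpectation 2 2 L 4 = y L 1 := by
  unfold plaquetteExpectation y W
  rw [wilsonExpectation_meanPlaquette_eq_plaquetteTrace (suRep 2) (continuous_suRep 2) _ (0 : Site 2 L)
    (show (0 : Fin 2) ≠ 1 by decide), ← wordLoop_plaquette, rep_one]

end Rows.C1SU2b4

/-- **Row C1-SU2_b4 of the cell, bound to the torus theory (FANOUT-PLAN A26(c)).** For `SU(2)`, `D = 2`,
`β_std = 4` and every torus side `L ≥ 1` on which the one-link Schwinger–Dyson row (1eq) and the backtrack row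
(2eq) hold for the canonical loop variables `y = (1, u, d, r, a, b_same, b_opp)` (torus expectations
`⟨W_0(rep v)⟩`): `⟨ū_P⟩_{(ℤ/L)², SU(2), β_std = 4} ≤ 457909750469907778563025 / 2⁷⁹ = 0.75754813577…` — the exact
bound of the certificate of record (sha256 `8028486716b8f522…`), replayed in the kernel by `Certificates.C1SU2b4`.
HONEST FRAMING: one lattice expectation at one stated coupling, conditional on two loop-equation rows; not a mass gap
/ continuum / large-`N` statement; not summit-bearing. -/
theorem row_C1_SU2_b4 (L : ℕ) [NeZero L]
    (h1eq : -1 + 3 / 2 * Rows.C1SU2b4.y L 1 + Rows.C1SU2b4.y L 2 - Rows.C1SU2b4.y L 3 + Rows.C1SU2b4.y L 4 = 0)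
    (h2eq : Rows.C1SU2b4.y L 3 - Rows.C1SU2b4.y L 4 - Rows.C1SU2b4.y L 5 + Rows.C1SU2b4.y L 6 = 0) :
    plaquetteExpectation 2 2 L 4 ≤ 457909750469907778563025 / 604462909807314587353088 := by
  rw [Rows.C1SU2b4.plaquetteExpectation_eq_y_one]
  exact Certificates.C1SU2b4.var_le_of_feasible (Rows.C1SU2b4.y_zero L) (Rows.C1SU2b4.abs_y_le_rho L)
    (Rows.C1SU2b4.rows_of_loopEquations L h1eq h2eq) (Rows.C1SU2b4.gramBlock_posSemidef L)

end Summit.QuantumFields.GaugeBoot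

end
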